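import Mathlib
import Summits.Ventures.PercRepro2.Defs
import Summits.Ventures.PercRepro2.Independence
import Summits.Ventures.PercRepro2.Harris
import Summits.Ventures.PercRepro2.Graph
import Summits.Ventures.PercRepro2.Exploration
import Summits.Ventures.PercRepro2.Events
import Summits.Ventures.PercRepro2.FourFunctions
import Summits.Ventures.PercRepro2.Induced
import Summits.Ventures.PercRepro2.Frontier
import Summits.Ventures.PercRepro2.ObsIndependence
import Summits.Ventures.PercRepro2.BHK
import Summits.Ventures.PercRepro2.BHKEvents
import Summits.Ventures.PercRepro2.BHKAvoid
import Summits.Ventures.PercRepro2.SameClusterAvoid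
import Summits.Ventures.PercRepro2.CaseOneRegime
import Summits.Ventures.PercRepro2.CaseOnePos
import Summits.Ventures.PercRepro2.CaseOneJ11
import Summits.Ventures.PercRepro2.CaseOneRV
import Summits.Ventures.PercRepro2.PathMixBHK
import Summits.Ventures.PercRepro2.CylinderCond
import Summits.Ventures.PercRepro2.CylinderCov

/-!
# PATHMIX in the kernel, modulo the stopping set: `PM ≥ 0 ⟹ (ii) = (RV)` (blind cell PercRepro2,
p1 g13; lead g24 00:04Z «(ii) = E¹[Cov(b∈C₂, o∈C₂ ∣ T)] + PM, PM ≥ 0 ⟹ (RV)», 00:15Z «the given-T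
BHK part … at a modified weight vector; the only new objects: the record T and the disintegration»)

Given ANY family of pairwise disjoint cylinders `cyl T` (`T ∈ s`) whose union is `{a₃ ∈ C₁}` (an
exploration STOPPING SET — e.g. the records of a canonical exploration from `a₁` halted when `a₃`
joins; the object typer-1 types), with `p_T = condWeights p (F T) (σ T)` and, per record,
`c_T = P(cyl T)`, `m_T = P_{p_T}(Q)`, `x_T = P_{p_T}(b ∈ C₂, Q)`, `y_T = P_{p_T}(o ∈ C₂, Q)`,
`z_T = P_{p_T}(b, o ∈ C₂, Q)`, `M = Σ_T c_T m_T = P(a₃ ∈ C₁, Q)`, `w_T = c_T m_T / M`: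

**`pmExpr := Σ_T w_T · (P_Q(b ∈ C₂) − x_T / m_T) · (γ − y_T / m_T)`**  (the lead's PM; `γ = D_o / D`),

and the **exact** identities: `iiExpr = P(Q)(D SZ − D_o SX) − P(b ∈ C₂, Q)(D SY − D_o M)` in the
disintegrated masses (**`iiExpr_eq_sums`**, via `CylinderCov.expect_mul_indicator_eq_sum`) and
`iiExpr / (P(Q) · D · M) = Σ_T w_T · Cov_{p_T}(b ∈ C₂, o ∈ C₂ ∣ Q) + pmExpr` (the law of total
covariance and the algebra `between + drop · slack = PM`, inside **`pm_algebra`**, the abstract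
form: masses `c, m`, per-record `x, y, z` with `x y ≤ z m`). The within part is `≥ 0` TERMWISE by
`PathMix.givenT_same_cluster` at `p_T` (**`within_nonneg`**; `condWeights = modWeights`:
**`condWeights_eq_modWeights`**), hence

**`zSplitII_of_pm`: `0 ≤ pmExpr ⟹ (ii)`** and **`rv_of_pm`: `0 ≤ pmExpr ⟹ (RV)`** — PATHMIX's
`PM ≥ 0 ⟹ (RV)` in the kernel for every stopping set. Census of `PM ≥ 0` (p1's DFS records): the
exhaustive binary-extreme bar at n = 6 (0 / 23,463,168 per palette), n ≤ 7 random palettes — no proof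
of `PM ≥ 0` is claimed. -/

namespace Summit.Ventures.PercRepro2

namespace PathMix

open CylinderCond CylinderCov

section Bridge
variable {E : Type*} [Fintype E] [DecidableEq E] {R : Type*} [CommRing R]

omit [Fintype E] in
/-- `condWeights` is `modWeights` for the explored-open / explored-closed parts of the cylinder. -/
theorem condWeights_eq_modWeights (p : E → R) (F : Finset E) (σ : Config E) :
    condWeights p F σ = modWeights p (F.filter fun e => σ e = true) (F.filter fun e => σ e = false) := by
  funext e
  unfold condWeights modWeights
  by_cases hF : e ∈ F
  · cases hσ : σ e <;> simp [hF, hσ]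
  · simp [hF]

end Bridge

section Kernel
variable {V : Type*} {E : Type*} [Fintype E] [DecidableEq E] [Fintype V] [DecidableEq V]
  {R : Type*} [Field R] [LinearOrder R] [IsStrictOrderedRing R]
variable {ι : Type*}

/-- The per-record masses of PATHMIX: `c_T`, `m_T`, `x_T`, `y_T`, `z_T` (events of the `b`/`o`
connections to `a₂` under `Q`, at the conditioned weights of the record). -/
noncomputable def recC (p : E → R) (F : ι → Finset E) (σ : ι → Config E) (T : ι) : R :=
  prob p (cylinder (F T) (σ T))

/-- `m_T = P_{p_T}(Q)`. -/
noncomputable def recM (p : E → R) (ends : E → Sym2 V) (a₁ a₂ : V) (F : ι → Finset E)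
    (σ : ι → Config E) (T : ι) : R :=
  expect (condWeights p (F T) (σ T)) (((connEvent ends a₁ a₂)ᶜ).indicator 1)

/-- `x_T = P_{p_T}(b ∈ C₂, Q)`. -/
noncomputable def recX (p : E → R) (ends : E → Sym2 V) (a₁ a₂ b : V) (F : ι → Finset E)
    (σ : ι → Config E) (T : ι) : R :=
  expect (condWeights p (F T) (σ T))
    (fun ω => (connEvent ends a₂ b).indicator 1 ω * ((connEvent ends a₁ a₂)ᶜ).indicator 1 ω)

/-- `z_T = P_{p_T}(b ∈ C₂, o ∈ C₂, Q)`. -/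
noncomputable def recZ (p : E → R) (ends : E → Sym2 V) (o a₁ a₂ b : V) (F : ι → Finset E)
    (σ : ι → Config E) (T : ι) : R :=
  expect (condWeights p (F T) (σ T))
    (fun ω => (connEvent ends a₂ b).indicator 1 ω * (connEvent ends a₂ o).indicator 1 ω *
      ((connEvent ends a₁ a₂)ᶜ).indicator 1 ω)

/-- **The lead's PM** for a family of records: `Σ_T w_T · (P_Q(b ∈ C₂) − x_T / m_T) · (γ − y_T / m_T)`
with `w_T = c_T m_T / M`, `M = Σ_T c_T m_T`, `γ = D_o / D`, `P_Q(b ∈ C₂) = P(b ∈ C₂, Q) / P(Q)`. -/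
noncomputable def pmExpr (p : E → R) (ends : E → Sym2 V) (o a₁ a₂ a₃ b : V) (s : Finset ι)
    (F : ι → Finset E) (σ : ι → Config E) : R :=
  ∑ T ∈ s, (recC p F σ T * recM p ends a₁ a₂ F σ T /
      ∑ T' ∈ s, recC p F σ T' * recM p ends a₁ a₂ F σ T') *
    (prob p (connEvent ends a₂ b ∩ (connEvent ends a₁ a₂)ᶜ) / prob p (connEvent ends a₁ a₂)ᶜ -
      recX p ends a₁ a₂ b F σ T / recM p ends a₁ a₂ F σ T) *
    (CaseOne.Dpdo p ends o a₁ a₂ a₃ / CaseOne.Dpd p ends a₁ a₂ a₃ -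
      recX p ends a₁ a₂ o F σ T / recM p ends a₁ a₂ F σ T)

/-- **The within-record covariance is nonnegative** (`m_T z_T − x_T y_T ≥ 0`, the (ii)-side BHK
part `PathMix.givenT_same_cluster` at the record's weights). -/
theorem within_nonneg (p : E → R) (hp : IsProbVec p) (ends : E → Sym2 V) (o a₁ a₂ b : V)
    (F : ι → Finset E) (σ : ι → Config E) (T : ι) :
    recX p ends a₁ a₂ b F σ T * recX p ends a₁ a₂ o F σ T ≤
      recZ p ends o a₁ a₂ b F σ T * recM p ends a₁ a₂ F σ T := by
  have h := givenT_same_cluster p hp ends o a₁ a₂ b (F T |>.filter fun e => σ T e = true)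
    (F T |>.filter fun e => σ T e = false)
  rw [← condWeights_eq_modWeights] at h
  unfold recX recZ recM
  rw [CaseOne.expect_ind2, CaseOne.expect_ind2, CaseOne.expect_ind3, ← prob_eq_expect_indicator]
  exact h

omit [Fintype V] [DecidableEq V] [LinearOrder R] [IsStrictOrderedRing R] in
/-- The disintegrated masses: `M = P(a₃ ∈ C₁, Q)` etc. -/
theorem sum_recCM (p : E → R) (ends : E → Sym2 V) (a₁ a₂ a₃ : V) {s : Finset ι}
    {F : ι → Finset E} {σ : ι → Config E} (h : IsCylinderPartition s F σ (connEvent ends a₁ a₃)) :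
    ∑ T ∈ s, recC p F σ T * recM p ends a₁ a₂ F σ T =
      expect p (fun ω => ((connEvent ends a₁ a₂)ᶜ).indicator 1 ω *
        (connEvent ends a₁ a₃).indicator 1 ω) := by
  rw [expect_mul_indicator_eq_sum p h]
  rfl

omit [Fintype V] [DecidableEq V] [LinearOrder R] [IsStrictOrderedRing R] in
/-- `SX = P(b ∈ C₂, Q, a₃ ∈ C₁)` (and `SY` with `o`). -/
theorem sum_recCX (p : E → R) (ends : E → Sym2 V) (a₁ a₂ a₃ b : V) {s : Finset ι}
    {F : ι → Finset E} {σ : ι → Config E} (h : IsCylinderPartition s F σ (connEvent ends a₁ a₃)) :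
    ∑ T ∈ s, recC p F σ T * recX p ends a₁ a₂ b F σ T =
      expect p (fun ω => ((connEvent ends a₂ b).indicator 1 ω *
        ((connEvent ends a₁ a₂)ᶜ).indicator 1 ω) * (connEvent ends a₁ a₃).indicator 1 ω) := by
  rw [expect_mul_indicator_eq_sum p h]
  rfl

omit [Fintype V] [DecidableEq V] [LinearOrder R] [IsStrictOrderedRing R] in
/-- `SZ = P(b, o ∈ C₂, Q, a₃ ∈ C₁)`. -/
theorem sum_recCZ (p : E → R) (ends : E → Sym2 V) (o a₁ a₂ a₃ b : V) {s : Finset ι}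
    {F : ι → Finset E} {σ : ι → Config E} (h : IsCylinderPartition s F σ (connEvent ends a₁ a₃)) :
    ∑ T ∈ s, recC p F σ T * recZ p ends o a₁ a₂ b F σ T =
      expect p (fun ω => ((connEvent ends a₂ b).indicator 1 ω * (connEvent ends a₂ o).indicator 1 ω *
        ((connEvent ends a₁ a₂)ᶜ).indicator 1 ω) * (connEvent ends a₁ a₃).indicator 1 ω) := by
  rw [expect_mul_indicator_eq_sum p h]
  rfl

omit [Fintype V] [DecidableEq V] [LinearOrder R] [IsStrictOrderedRing R] in
/-- **`iiExpr` in the disintegrated masses**: with `Q₀ = P(Q)`, `M`, `SX`, `SY`, `SZ` as above,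
`iiExpr = Q₀ · (D · SZ − D_o · SX) − P(b ∈ C₂, Q) · (D · SY − D_o · M)`. -/
theorem iiExpr_eq_sums (p : E → R) (ends : E → Sym2 V) (o a₁ a₂ a₃ b : V) {s : Finset ι}
    {F : ι → Finset E} {σ : ι → Config E} (h : IsCylinderPartition s F σ (connEvent ends a₁ a₃)) :
    CaseOne.iiExpr p ends o a₁ a₂ a₃ b =
      prob p (connEvent ends a₁ a₂)ᶜ *
          (CaseOne.Dpd p ends a₁ a₂ a₃ * (∑ T ∈ s, recC p F σ T * recZ p ends o a₁ a₂ b F σ T) -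
            CaseOne.Dpdo p ends o a₁ a₂ a₃ * (∑ T ∈ s, recC p F σ T * recX p ends a₁ a₂ b F σ T)) -
        prob p (connEvent ends a₂ b ∩ (connEvent ends a₁ a₂)ᶜ) *
          (CaseOne.Dpd p ends a₁ a₂ a₃ * (∑ T ∈ s, recC p F σ T * recX p ends a₁ a₂ o F σ T) -
            CaseOne.Dpdo p ends o a₁ a₂ a₃ * (∑ T ∈ s, recC p F σ T * recM p ends a₁ a₂ F σ T)) := by
  rw [sum_recCZ p ends o a₁ a₂ a₃ b h, sum_recCX p ends a₁ a₂ a₃ b h, sum_recCX p ends a₁ a₂ a₃ o h,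
    sum_recCM p ends a₁ a₂ a₃ h]
  unfold CaseOne.iiExpr CaseOne.zFun
  have e1 : expect p (fun ω => (connEvent ends a₂ b).indicator (1 : Config E → R) ω *
      ((connEvent ends a₁ a₃).indicator 1 ω *
        (CaseOne.Dpd p ends a₁ a₂ a₃ * (connEvent ends a₂ o).indicator 1 ω -
          CaseOne.Dpdo p ends o a₁ a₂ a₃)) * ((connEvent ends a₁ a₂)ᶜ).indicator 1 ω) =
      CaseOne.Dpd p ends a₁ a₂ a₃ * expect p (fun ω => (connEvent ends a₂ b).indicator 1 ω *
          (connEvent ends a₂ o).indicator 1 ω * ((connEvent ends a₁ a₂)ᶜ).indicator 1 ω *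
          (connEvent ends a₁ a₃).indicator 1 ω) -
        CaseOne.Dpdo p ends o a₁ a₂ a₃ * expect p (fun ω => (connEvent ends a₂ b).indicator 1 ω *
          ((connEvent ends a₁ a₂)ᶜ).indicator 1 ω * (connEvent ends a₁ a₃).indicator 1 ω) := by
    rw [← expect_const_mul, ← expect_const_mul, ← expect_sub]
    congr 1
    funext ω
    simp only [Pi.sub_apply]
    ring
  have e2 : expect p (fun ω => (connEvent ends a₁ a₃).indicator (1 : Config E → R) ω *
      (CaseOne.Dpd p ends a₁ a₂ a₃ * (connEvent ends a₂ o).indicator 1 ω -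
        CaseOne.Dpdo p ends o a₁ a₂ a₃) * ((connEvent ends a₁ a₂)ᶜ).indicator 1 ω) =
      CaseOne.Dpd p ends a₁ a₂ a₃ * expect p (fun ω => (connEvent ends a₂ o).indicator 1 ω *
          ((connEvent ends a₁ a₂)ᶜ).indicator 1 ω * (connEvent ends a₁ a₃).indicator 1 ω) -
        CaseOne.Dpdo p ends o a₁ a₂ a₃ * expect p (fun ω => ((connEvent ends a₁ a₂)ᶜ).indicator 1 ω *
          (connEvent ends a₁ a₃).indicator 1 ω) := by
    rw [← expect_const_mul, ← expect_const_mul, ← expect_sub]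
    congr 1
    funext ω
    simp only [Pi.sub_apply]
    ring
  rw [e1, e2, CaseOne.expect_ind2]

/-- **The algebra of PATHMIX, abstractly**: masses `c, m ≥ 0`, per-record `x, y, z` with
`x y ≤ z m` (the within-record BHK part) and vanishing on degenerate records, `M = Σ c m > 0`,
`SX, SY, SZ` the disintegrated sums; if `PM := Σ (c m / M)(P₀ − x/m)(G − y/m) ≥ 0` then
`Q₀ (D SZ − Do SX) − PQb (D SY − Do M) ≥ 0` where `P₀ = PQb / Q₀`, `G = Do / D`. -/
theorem pm_algebra {s : Finset ι} (c m x y z : ι → R) (hc0 : ∀ T, 0 ≤ c T) (hm0 : ∀ T, 0 ≤ m T)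
    (hdeg : ∀ T, m T = 0 → x T = 0 ∧ y T = 0 ∧ z T = 0)
    (hwithin : ∀ T, x T * y T ≤ z T * m T)
    (hM : 0 < ∑ T ∈ s, c T * m T) (Q₀ D Do PQb : R) (hQ : 0 < Q₀) (hD : 0 < D)
    (hpm : 0 ≤ ∑ T ∈ s, (c T * m T / ∑ T' ∈ s, c T' * m T') *
      (PQb / Q₀ - x T / m T) * (Do / D - y T / m T)) :
    0 ≤ Q₀ * (D * (∑ T ∈ s, c T * z T) - Do * (∑ T ∈ s, c T * x T)) -
      PQb * (D * (∑ T ∈ s, c T * y T) - Do * (∑ T ∈ s, c T * m T)) := by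
  classical
  set M := ∑ T ∈ s, c T * m T with hMdef
  set SX := ∑ T ∈ s, c T * x T with hSX
  set SY := ∑ T ∈ s, c T * y T with hSY
  set SZ := ∑ T ∈ s, c T * z T with hSZ
  have hM0 : M ≠ 0 := ne_of_gt hM
  -- per-record identities (degenerate records contribute 0 on both sides)
  have key : ∀ T ∈ s, (c T * m T / M) * (z T / m T) = c T * z T / M ∧
      (c T * m T / M) * (x T / m T) = c T * x T / M ∧
      (c T * m T / M) * (y T / m T) = c T * y T / M := by
    intro T _
    by_cases hmT : m T = 0
    · obtain ⟨hx, hy, hz⟩ := hdeg T hmT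
      simp [hmT, hx, hy, hz]
    · refine ⟨?_, ?_, ?_⟩
      all_goals field_simp
  have hsum1 : ∑ T ∈ s, (c T * m T / M) = 1 := by
    rw [← Finset.sum_div]; exact div_self hM0
  have hsumz : ∑ T ∈ s, (c T * m T / M) * (z T / m T) = SZ / M := by
    rw [hSZ, Finset.sum_div]; exact Finset.sum_congr rfl fun T hT => (key T hT).1
  have hsumx : ∑ T ∈ s, (c T * m T / M) * (x T / m T) = SX / M := by
    rw [hSX, Finset.sum_div]; exact Finset.sum_congr rfl fun T hT => (key T hT).2.1
  have hsumy : ∑ T ∈ s, (c T * m T / M) * (y T / m T) = SY / M := by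
    rw [hSY, Finset.sum_div]; exact Finset.sum_congr rfl fun T hT => (key T hT).2.2
  -- the within part is nonnegative termwise
  have hwithin' : ∀ T ∈ s, 0 ≤ (c T * m T / M) * (z T / m T - (x T / m T) * (y T / m T)) := by
    intro T _
    by_cases hmT : m T = 0
    · simp [hmT]
    · have hmpos : 0 < m T := lt_of_le_of_ne (hm0 T) (Ne.symm hmT)
      have hw : 0 ≤ c T * m T / M := div_nonneg (mul_nonneg (hc0 T) (hm0 T)) hM.le
      refine mul_nonneg hw ?_
      have : z T / m T - (x T / m T) * (y T / m T) = (z T * m T - x T * y T) / (m T * m T) := by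
        field_simp
      rw [this]
      exact div_nonneg (by linarith [hwithin T]) (mul_nonneg hmpos.le hmpos.le)
  have hW : 0 ≤ ∑ T ∈ s, (c T * m T / M) * (z T / m T - (x T / m T) * (y T / m T)) :=
    Finset.sum_nonneg hwithin'
  -- expand PM and the within sum termwise; everything reduces to the four sum identities
  have expandPM : ∀ T ∈ s, (c T * m T / M) * (PQb / Q₀ - x T / m T) * (Do / D - y T / m T) =
      (PQb / Q₀) * (Do / D) * (c T * m T / M) - (PQb / Q₀) * ((c T * m T / M) * (y T / m T)) -
        (Do / D) * ((c T * m T / M) * (x T / m T)) +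
        ((c T * m T / M) * (x T / m T)) * (y T / m T) := by
    intro T _; ring
  have expandW : ∀ T ∈ s, (c T * m T / M) * (z T / m T - (x T / m T) * (y T / m T)) =
      (c T * m T / M) * (z T / m T) - ((c T * m T / M) * (x T / m T)) * (y T / m T) := by
    intro T _; ring
  rw [Finset.sum_congr rfl expandPM] at hpm
  rw [Finset.sum_congr rfl expandW] at hW
  rw [Finset.sum_add_distrib, Finset.sum_sub_distrib, Finset.sum_sub_distrib, ← Finset.mul_sum,
    ← Finset.mul_sum, ← Finset.mul_sum, hsum1, hsumx, hsumy] at hpm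
  rw [Finset.sum_sub_distrib, hsumz] at hW
  -- the mixed sum `Σ (c m / M)(x/m)(y/m)` appears in both; eliminate it
  set MIX := ∑ T ∈ s, ((c T * m T / M) * (x T / m T)) * (y T / m T) with hMIX
  have hQ0 : Q₀ ≠ 0 := ne_of_gt hQ
  have hD0 : D ≠ 0 := ne_of_gt hD
  have hpos : 0 < Q₀ * D * M := mul_pos (mul_pos hQ hD) hM
  -- target / (Q₀ D M) = (SZ/M − MIX) + [(PQb/Q₀)(Do/D) − (PQb/Q₀)(SY/M) − (Do/D)(SX/M) + MIX]
  have hdiv : (Q₀ * (D * SZ - Do * SX) - PQb * (D * SY - Do * M)) / (Q₀ * D * M) =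
      (SZ / M - MIX) + ((PQb / Q₀) * (Do / D) * 1 - (PQb / Q₀) * (SY / M) - (Do / D) * (SX / M) + MIX) := by
    field_simp
    ring
  have hnn : 0 ≤ (Q₀ * (D * SZ - Do * SX) - PQb * (D * SY - Do * M)) / (Q₀ * D * M) := by
    rw [hdiv]
    linarith
  rcases div_nonneg_iff.1 hnn with ⟨h1, _⟩ | ⟨_, h2⟩
  · exact h1
  · linarith

/-- **PATHMIX in the kernel**: for every cylinder partition of `{a₃ ∈ C₁}` with `P(Q), D, M > 0`,
`0 ≤ pmExpr ⟹ (ii)` (the within part is nonnegative termwise, `within_nonneg`). -/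
theorem zSplitII_of_pm (p : E → R) (hp : IsProbVec p) (ends : E → Sym2 V) (o a₁ a₂ a₃ b : V)
    {s : Finset ι} {F : ι → Finset E} {σ : ι → Config E}
    (h : IsCylinderPartition s F σ (connEvent ends a₁ a₃))
    (hQ : 0 < prob p (connEvent ends a₁ a₂)ᶜ) (hD : 0 < CaseOne.Dpd p ends a₁ a₂ a₃)
    (hM : 0 < ∑ T ∈ s, recC p F σ T * recM p ends a₁ a₂ F σ T)
    (hpm : 0 ≤ pmExpr p ends o a₁ a₂ a₃ b s F σ) :
    CaseOne.ZSplitII p ends o a₁ a₂ a₃ b := by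
  unfold CaseOne.ZSplitII
  rw [iiExpr_eq_sums p ends o a₁ a₂ a₃ b h]
  refine pm_algebra (recC p F σ) (recM p ends a₁ a₂ F σ) (recX p ends a₁ a₂ b F σ)
    (recX p ends a₁ a₂ o F σ) (recZ p ends o a₁ a₂ b F σ) (fun T => prob_nonneg hp _)
    (fun T => expect_nonneg (isProbVec_condWeights hp (F T) (σ T)) fun _ =>
      Set.indicator_apply_nonneg fun _ => zero_le_one) ?_ (within_nonneg p hp ends o a₁ a₂ b F σ)
    hM _ _ _ _ hQ hD hpm
  intro T hmT
  have hq := isProbVec_condWeights hp (F T) (σ T)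
  refine ⟨expect_mul_indicator_eq_zero hq _ hmT _, expect_mul_indicator_eq_zero hq _ hmT _, ?_⟩
  have := expect_mul_indicator_eq_zero hq ((connEvent ends a₁ a₂)ᶜ) hmT
    (fun ω => (connEvent ends a₂ b).indicator 1 ω * (connEvent ends a₂ o).indicator 1 ω)
  exact this

/-- **`PM ≥ 0 ⟹ (RV)`** (when the required-vertex world has positive mass). -/
theorem rv_of_pm (p : E → R) (hp : IsProbVec p) (ends : E → Sym2 V) (o a₁ a₂ a₃ b : V)
    {s : Finset ι} {F : ι → Finset E} {σ : ι → Config E}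
    (h : IsCylinderPartition s F σ (connEvent ends a₁ a₃))
    (hQ : 0 < prob p (connEvent ends a₁ a₂)ᶜ) (hD : 0 < CaseOne.Dpd p ends a₁ a₂ a₃)
    (hM : 0 < ∑ T ∈ s, recC p F σ T * recM p ends a₁ a₂ F σ T)
    (hT : 0 < prob p (CaseOne.Tp ends a₁ a₂ a₃))
    (hpm : 0 ≤ pmExpr p ends o a₁ a₂ a₃ b s F σ) :
    CaseOne.RV p ends o a₁ a₂ a₃ b :=
  (CaseOne.rv_iff_ii p ends o a₁ a₂ a₃ b hT).2
    (zSplitII_of_pm p hp ends o a₁ a₂ a₃ b h hQ hD hM hpm)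

end Kernel

end PathMix

end Summit.Ventures.PercRepro2
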